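import Mathlib
import HarnessLib.Audit
import Summits.PneNP.PneNP.Theorems.PstarUnionAtoms

/-!
# Chords absorb: every assignment corrects to a solution of the core on the forest vertices and the chord privates (ROUND-24, memo §14.13 PC1; A1)

FRONTIER range-avoidance ladder, rung F-N3, ROUND 24 (cell `pnp-ideate`, planner memo `r24/CORE-BOUND-NOTES.md` §14.13 PC1, typed sketch `r24/SketchAtoms.lean` of planner
p3 g22, statement A1 VERBATIM; restricted-model proof complexity — nothing here bears on `P` versus `NP`).

* `exists_leaf` — a vertex of XOR degree one in `S` belongs to exactly one output of `S`, in an XOR slot;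
* `solve_forest` — a peelable (XOR-acyclic) family is solvable by changing XOR vertices only (leaf peeling);
* `solve_chords` — after the forest, each chord `c` is fixed by its private pair `(κ, κ)`, `κ = x_u + x_v + y_c` (`IsChord` keeps the privates out of every
  other output);
* `solF_extend` — **A1 (CHORDS ABSORB)**: `F ⊆ J₀` peelable, `J₀ ∖ F` chords ⟹ every `z` is corrected on `privs(J₀ ∖ F) ∪ xvars(J₀)` alone into a solution of `J₀`.
-/

set_option linter.dupNamespace false -- `Summit.PneNP.PneNP.…`: summit = sub-problem name (D-0017 single-conjunct layout)

open Finset Literature.Computability.Complexity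
open Summit.PneNP.PneNP.Theorems.PstarTyped (Typed)
open Summit.PneNP.PneNP.Theorems.PstarSALevel (varSet bdry BoundaryExpanding SimpleOverlap)
open Summit.PneNP.PneNP.Theorems.PstarGapPeeling (not_mem_varSet_of_private eval_update_of_not_mem eval_update_xor_slot eval_update_and_pair)
open Summit.PneNP.PneNP.Theorems.PstarCentreFree (vars_mem_varSet)
open Summit.PneNP.PneNP.Theorems.PstarChordRepair (IsChord)
open Summit.PneNP.PneNP.Theorems.PstarChordBridgeCotree (Peelable)
open Summit.PneNP.PneNP.Theorems.PstarChordBridgeTools (privs mem_privs xpdeg)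
open Summit.PneNP.PneNP.Theorems.PstarUnionAtoms (xvars)

namespace Summit.PneNP.PneNP.Theorems.PstarUnionAbsorb

variable {n m : ℕ}

/-- Membership in `xvars`. -/
theorem mem_xvars (I : LocalMap 4 n m) {J : Finset (Fin m)} {v : Fin n} : v ∈ xvars I J ↔ ∃ j ∈ J, I.vars j 0 = v ∨ I.vars j 1 = v := by
  unfold PstarUnionAtoms.xvars
  simp only [mem_biUnion, mem_insert, mem_singleton]
  constructor
  · rintro ⟨j, hj, h⟩; exact ⟨j, hj, by rcases h with h | h <;> [exact Or.inl h.symm; exact Or.inr h.symm]⟩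
  · rintro ⟨j, hj, h⟩; exact ⟨j, hj, by rcases h with h | h <;> [exact Or.inl h.symm; exact Or.inr h.symm]⟩

/-- **A leaf**: a vertex of XOR degree one in `S` lies in an XOR slot of exactly one output of `S`. -/
theorem exists_leaf (I : LocalMap 4 n m) {S : Finset (Fin m)} {w : Fin n} (hw : xpdeg I S w = 1) :
    ∃ j ∈ S, ∃ s : Fin 4, s.val < 2 ∧ I.vars j s = w ∧ ∀ j' ∈ S, j' ≠ j → I.vars j' 0 ≠ w ∧ I.vars j' 1 ≠ w := by
  classical
  unfold PstarChordBridgeTools.xpdeg PstarXorElimination.pdeg at hw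
  set f0 := S.filter (fun j => I.vars j 0 = w) with hf0
  set f1 := S.filter (fun j => I.vars j 1 = w) with hf1
  rcases Nat.eq_zero_or_pos f0.card with h0 | h0
  · -- the leaf sits in slot 1
    have h1 : f1.card = 1 := by omega
    obtain ⟨j, hj⟩ := card_eq_one.1 h1
    have hjm : j ∈ f1 := by rw [hj]; exact mem_singleton_self j
    rw [hf1, mem_filter] at hjm
    refine ⟨j, hjm.1, 1, by decide, hjm.2, fun j' hj' hne => ⟨fun h => ?_, fun h => ?_⟩⟩
    · have : j' ∈ f0 := by rw [hf0]; exact mem_filter.2 ⟨hj', h⟩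
      rw [card_eq_zero.1 h0] at this; exact notMem_empty _ this
    · have : j' ∈ f1 := by rw [hf1]; exact mem_filter.2 ⟨hj', h⟩
      rw [hj, mem_singleton] at this; exact hne this
  · have h0' : f0.card = 1 := by omega
    have h1 : f1.card = 0 := by omega
    obtain ⟨j, hj⟩ := card_eq_one.1 h0'
    have hjm : j ∈ f0 := by rw [hj]; exact mem_singleton_self j
    rw [hf0, mem_filter] at hjm
    refine ⟨j, hjm.1, 0, by decide, hjm.2, fun j' hj' hne => ⟨fun h => ?_, fun h => ?_⟩⟩
    · have : j' ∈ f0 := by rw [hf0]; exact mem_filter.2 ⟨hj', h⟩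
      rw [hj, mem_singleton] at this; exact hne this
    · have : j' ∈ f1 := by rw [hf1]; exact mem_filter.2 ⟨hj', h⟩
      rw [card_eq_zero.1 h1] at this; exact notMem_empty _ this

/-- **Leaf peeling solves a peelable family on its XOR vertices.** -/
theorem solve_forest (I : LocalMap 4 n m) (hI : I.IsPure xorAndPred) (hT : Typed I) (y : Fin m → Bool) {F : Finset (Fin m)} (hP : Peelable I F) :
    ∀ (k : ℕ) (S : Finset (Fin m)), S ⊆ F → S.card ≤ k → ∀ z : Fin n → Bool,
      ∃ z' : Fin n → Bool, (∀ j ∈ S, I.eval z' j = y j) ∧ ∀ v, v ∉ xvars I S → z' v = z v := by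
  classical
  intro k
  induction k with
  | zero =>
    intro S _ hk z
    rw [Nat.le_zero, card_eq_zero] at hk
    subst hk
    exact ⟨z, fun j hj => absurd hj (notMem_empty j), fun _ _ => rfl⟩
  | succ k ih =>
    intro S hSF hk z
    rcases S.eq_empty_or_nonempty with rfl | hne
    · exact ⟨z, fun j hj => absurd hj (notMem_empty j), fun _ _ => rfl⟩
    obtain ⟨w, hw⟩ := hP S hSF hne
    obtain ⟨j, hj, s, hs, hjs, hother⟩ := exists_leaf I hw
    obtain ⟨z₁, hz₁, hagree⟩ := ih (S.erase j) ((erase_subset j S).trans hSF) (by rw [card_erase_of_mem hj]; omega) z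
    -- `w` occurs in no other output of `S`
    have hwS : ∀ j' ∈ S, j' ≠ j → w ∉ varSet I j' := by
      intro j' hj' hne' hmem
      unfold PstarSALevel.varSet at hmem
      obtain ⟨s', -, hs'⟩ := mem_image.1 hmem
      by_cases hlt : s'.val < 2
      · have : s' = 0 ∨ s' = 1 := by
          rcases s' with ⟨_ | _ | q, hq⟩
          · exact Or.inl rfl
          · exact Or.inr rfl
          · exact absurd hlt (by simp)
        rcases this with rfl | rfl
        · exact (hother j' hj' hne').1 hs'
        · exact (hother j' hj' hne').2 hs'
      · exact hT j j' s s' hs (by omega) (hjs.trans hs'.symm)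
    -- fix `j` by its leaf
    by_cases hok : I.eval z₁ j = y j
    · refine ⟨z₁, fun j' hj' => ?_, fun v hv => hagree v fun h => hv ?_⟩
      · by_cases hjj : j' = j
        · rw [hjj]; exact hok
        · exact hz₁ j' (mem_erase.2 ⟨hjj, hj'⟩)
      · obtain ⟨j'', hj'', h⟩ := (mem_xvars I).1 h
        exact (mem_xvars I).2 ⟨j'', mem_of_mem_erase hj'', h⟩
    · refine ⟨Function.update z₁ w (!z₁ w), fun j' hj' => ?_, fun v hv => ?_⟩
      · by_cases hjj : j' = j
        · subst hjj
          rw [← hjs, eval_update_xor_slot I hI z₁ j' s hs]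
          revert hok; cases I.eval z₁ j' <;> cases y j' <;> simp
        · rw [eval_update_of_not_mem I j' z₁ (hwS j' hj' hjj)]
          exact hz₁ j' (mem_erase.2 ⟨hjj, hj'⟩)
      · have hvw : v ≠ w := by
          intro h
          apply hv
          rw [h, ← hjs]
          exact (mem_xvars I).2 ⟨j, hj, by
            have : s = 0 ∨ s = 1 := by
              rcases s with ⟨_ | _ | q, hq⟩
              · exact Or.inl rfl
              · exact Or.inr rfl
              · exact absurd hs (by simp)
            rcases this with rfl | rfl
            · exact Or.inl rfl
            · exact Or.inr rfl⟩
        rw [Function.update_of_ne hvw]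
        refine hagree v fun h => hv ?_
        obtain ⟨j'', hj'', h⟩ := (mem_xvars I).1 h
        exact (mem_xvars I).2 ⟨j'', mem_of_mem_erase hj'', h⟩

/-- **After the forest, the chords are fixed one by one on their private pairs.** -/
theorem solve_chords (I : LocalMap 4 n m) (hI : I.IsPure xorAndPred) (y : Fin m → Bool) {J₀ F : Finset (Fin m)} (hF : F ⊆ J₀)
    (hchord : ∀ e ∈ J₀ \ F, IsChord I J₀ e) :
    ∀ (k : ℕ) (C : Finset (Fin m)), C ⊆ J₀ \ F → C.card ≤ k → ∀ z : Fin n → Bool, (∀ j ∈ F, I.eval z j = y j) →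
      ∃ z' : Fin n → Bool, (∀ j ∈ F ∪ C, I.eval z' j = y j) ∧ ∀ v, v ∉ privs I C → z' v = z v := by
  classical
  intro k
  induction k with
  | zero =>
    intro C _ hk z hz
    rw [Nat.le_zero, card_eq_zero] at hk
    subst hk
    exact ⟨z, fun j hj => hz j (by simpa using hj), fun _ _ => rfl⟩
  | succ k ih =>
    intro C hC hk z hz
    rcases C.eq_empty_or_nonempty with rfl | ⟨c, hc⟩
    · exact ⟨z, fun j hj => hz j (by simpa using hj), fun _ _ => rfl⟩
    obtain ⟨z₁, hz₁, hagree⟩ := ih (C.erase c) ((erase_subset c C).trans hC) (by rw [card_erase_of_mem hc]; omega) z hz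
    have hcJ : c ∈ J₀ := (mem_sdiff.1 (hC hc)).1
    have hch := hchord c (hC hc)
    -- the private pair of `c` set to `(κ, κ)`
    let κ : Bool := xor (xor (z₁ (I.vars c 0)) (z₁ (I.vars c 1))) (y c)
    refine ⟨Function.update (Function.update z₁ (I.vars c 2) κ) (I.vars c 3) κ, fun j hj => ?_, fun v hv => ?_⟩
    · by_cases hjc : j = c
      · subst hjc
        rw [eval_update_and_pair I hI z₁ j κ]
        show xor (xor (z₁ (I.vars j 0)) (z₁ (I.vars j 1))) (xor (xor (z₁ (I.vars j 0)) (z₁ (I.vars j 1))) (y j)) = y j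
        cases z₁ (I.vars j 0) <;> cases z₁ (I.vars j 1) <;> cases y j <;> rfl
      · have hjJ : j ∈ J₀ := by
          rcases mem_union.1 hj with h | h
          · exact hF h
          · exact (mem_sdiff.1 (hC h)).1
        rw [eval_update_of_not_mem I j _ (not_mem_varSet_of_private I hcJ hjJ hjc hch.2 (vars_mem_varSet I c 3)),
          eval_update_of_not_mem I j _ (not_mem_varSet_of_private I hcJ hjJ hjc hch.1 (vars_mem_varSet I c 2))]
        rcases mem_union.1 hj with h | h
        · exact hz₁ j (mem_union_left _ h)
        · exact hz₁ j (mem_union_right _ (mem_erase.2 ⟨hjc, h⟩))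
    · have hv2 : v ≠ I.vars c 2 := fun h => hv ((mem_privs I).2 ⟨c, hc, Or.inl h.symm⟩)
      have hv3 : v ≠ I.vars c 3 := fun h => hv ((mem_privs I).2 ⟨c, hc, Or.inr h.symm⟩)
      rw [Function.update_of_ne hv3, Function.update_of_ne hv2]
      exact hagree v fun h => hv (PstarChordBridgeExchange.privs_mono I (erase_subset c C) h)

/-- **A1 — CHORDS ABSORB (PC1).**  If `F ⊆ J₀` is peelable (XOR-acyclic) and every output of `J₀ ∖ F` is a chord (both AND variables private in
`J₀`), then every assignment can be corrected on the chord privates and the XOR vertices of `J₀` alone into a solution of `J₀` (p3's statement verbatim). -/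
theorem solF_extend (I : LocalMap 4 n m) (hI : I.IsPure xorAndPred) (hT : Typed I) (_hS : SimpleOverlap I) (y : Fin m → Bool)
    {J₀ F : Finset (Fin m)} (hF : F ⊆ J₀) (hP : Peelable I F) (hchord : ∀ e ∈ J₀ \ F, IsChord I J₀ e) (z : Fin n → Bool) :
    ∃ z' : Fin n → Bool, (∀ j ∈ J₀, I.eval z' j = y j) ∧ ∀ v, v ∉ privs I (J₀ \ F) → v ∉ xvars I J₀ → z' v = z v := by
  classical
  obtain ⟨z₁, hz₁, hag₁⟩ := solve_forest I hI hT y hP F.card F (Subset.refl F) le_rfl z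
  obtain ⟨z₂, hz₂, hag₂⟩ := solve_chords I hI y hF hchord (J₀ \ F).card (J₀ \ F) (Subset.refl _) le_rfl z₁ hz₁
  refine ⟨z₂, fun j hj => hz₂ j (by rw [union_sdiff_of_subset hF]; exact hj), fun v hvp hvx => ?_⟩
  rw [hag₂ v hvp]
  refine hag₁ v fun h => hvx ?_
  obtain ⟨j, hj, hj'⟩ := (mem_xvars I).1 h
  exact (mem_xvars I).2 ⟨j, hF hj, hj'⟩

end Summit.PneNP.PneNP.Theorems.PstarUnionAbsorb
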